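import Summits.Ventures.CertifiedManyBodySolver.Observables.NeelClassFloorFourthMoment
import HarnessLib

/-!
# Ventures/CertifiedManyBodySolver — Observables/NeelClassFloorQuad.lean
# The SDW-reference kinetic floor with QUADRATIC MAJORANTS of `√(x + Δ²)` read by the band moments
# `Σ_k ε_k² = 4t²L²`, `Σ_k ε_k⁴ = 36t⁴L²` (part 5; part 4 = `NeelClassFloorFourthMoment.lean`)

HONEST FRAMING: first certified bounds; not a superconductivity verdict; every number certified or labelled float.
A competing-order EXCLUSION removes a named class of candidate ground states; it never says which order is present;
no phase sentence follows.

Cell `hubbard-tc` (MO-S3, D-0096), seat `hubbard-tc-mod-3` (G3), `prover-hubbard-tc-mod-3-g7-0`. The floor of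
`NeelClassKineticFloor.lean` bounds `tr E = Σ_k √(ε_k² + Δ²)` by Cauchy–Schwarz, `L²√(4t² + Δ²)` (second band moment
`Σ_k ε_k² = 4t²L²` only), which loses `≈ 0.05·t` per site at the binding staggered field and `≈ 0.4·t` at small fields. Here:

* §2 `re_expect_hubbardTorusTT'_zero_ge_sdw_of_trace_le`: the floor of part 3 with an ABSTRACT bound `tr E ≤ L²·B`;
* §3 `trace_sdwE_matrix_le_quad`: for every quadratic majorant `√(x + Δ²) ≤ α + βx + γx²` on `[0, 16t²]`,
  `tr E ≤ L²(α + 4t²β + 36t⁴γ)`; hence `re_expect_hubbardTorusTT'_zero_ge_sdw_quad` and the class floors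
  `re_expect_hubbardTorusTT'_ge_neelClass_quad` / `neelClass_energy_per_site_ge_quad`:
  energy per site `≥ 2δ|m| + δ(1 − n) − (α + 4β + 36γ) + U(n²/4 − m²)` (t = 1) for every admissible `δ` and every
  quadratic majorant of `√(x + δ²)` on `[0, 16]` (e.g. the tangent parabolas at a rational point `x₁ = ρ² − δ²`:
  gain `0.17 / 0.13 / 0.047·t` at `δ = 1/4 / 1 / 2.7` over the Cauchy–Schwarz floor).
Everything is PROVED; no definition, no named fact, no `sorry`.

References: E. H. Lieb, M. Loss, Duke Math. J. 71 (1993) 337, §8 [LiebLoss1993]; S. Friedli, Y. Velenik, Statistical Mechanics of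
Lattice Systems (2017), §10.4 (characters of the torus) [FriedliVelenik2017]; J. S. Langer, D. C. Mattis, Phys. Lett. 36A (1971) 139
[LangerMattis1971]; V. Bach, E. H. Lieb, J. P. Solovej, J. Stat. Phys. 76 (1994) 3, §2 eq. (2c.36) [BachLiebSolovej1994].
-/

noncomputable section

namespace Summit.Ventures.CertifiedManyBodySolver.Observables

namespace NeelClassFloor

open Literature.MathematicalPhysics.QuantumLattice

open Matrix Finset Literature.Probability.LatticeModels
  Literature.MathematicalPhysics.QuantumLattice.RayleighBound
  Literature.MathematicalPhysics.QuantumLattice.HubbardBandBottom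
  Literature.MathematicalPhysics.QuantumLattice.LangerMattis
  Literature.MathematicalPhysics.QuantumLattice.HartreeFock
  Literature.MathematicalPhysics.QuantumLattice.TTPrimeFree
  Literature.MathematicalPhysics.QuantumLattice.FreeKinetic
open scoped ComplexOrder ComplexConjugate

variable {L : ℕ}
/-! ### §2 The kinetic floor with an abstract trace bound `tr E ≤ L²·B` -/

section Main

variable [NeZero L]

/-- **The SDW-reference kinetic floor with an abstract band-sum bound** (`t' ≤ 0`): if
`tr √(K² + Δ²) ≤ L²·B` then for every Fock vector `φ`,
`-Δ Re⟨φ, Ôφ⟩ + |Δ|(L²‖φ‖² - Re⟨φ, N̂φ⟩) - L²·B·‖φ‖² ≤ Re⟨φ, H(t,t',0)φ⟩` (same proof as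
`re_expect_hubbardTorusTT'_zero_ge_sdw`, the Cauchy–Schwarz step replaced by the hypothesis).
[cite: LiebLoss1993, §8, Theorem 8.2] -/
theorem re_expect_hubbardTorusTT'_zero_ge_sdw_of_trace_le (hL : 3 ≤ L) (hLe : Even L) (t : ℝ) {t' Δ B : ℝ}
    (ht' : t' ≤ 0) (hΔ : Δ ≠ 0) (h4 : 4 * |t'| ≤ |Δ|) (hD : |Δ| * |t'| ≤ 2 * (t ^ 2 - t' ^ 2))
    (hB : ((sdwM 2 L (-t) Δ * sdwR 2 L (-t) Δ).trace).re ≤ (L : ℝ) ^ 2 * B)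
    (φ : Fock (Orb (FermionTorus 2 L))) :
    -Δ * (star φ ⬝ᵥ ((dGammaSpin 0 (stagMatrix 2 L) - dGammaSpin 1 (stagMatrix 2 L)) *ᵥ φ)).re +
        |Δ| * ((L : ℝ) ^ 2 * normSq φ - (star φ ⬝ᵥ (totalNumber *ᵥ φ)).re) -
        (L : ℝ) ^ 2 * B * normSq φ ≤
      (star φ ⬝ᵥ (hubbardTorusTT' L t t' 0 *ᵥ φ)).re := by
  -- the side conditions in terms of the diagonal hopping parameter `-t' ≥ 0`
  have hτ : 0 ≤ -t' := by linarith
  have habs : |t'| = -t' := abs_of_nonpos ht'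
  have h2τ : 2 * (-t') ≤ |Δ| := by rw [← habs]; linarith [abs_nonneg t']
  have h4τ : 4 * |(-t')| ≤ |Δ| := by rwa [abs_neg]
  have hDτ : |Δ| * (-t') ≤ 2 * ((-t) ^ 2 - (-t') ^ 2) := by rw [neg_sq t, neg_sq t', ← habs]; exact hD
  -- opaque names for the one-body matrices
  obtain ⟨K', hK'⟩ : ∃ K' : Matrix (FermionTorus 2 L) (FermionTorus 2 L) ℂ,
      K' = hopMatrix (fermionTorusDiagGraph L) (-t') := ⟨_, rfl⟩
  obtain ⟨E, hE⟩ : ∃ E : Matrix (FermionTorus 2 L) (FermionTorus 2 L) ℂ,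
      E = sdwM 2 L (-t) Δ * sdwR 2 L (-t) Δ := ⟨_, rfl⟩
  obtain ⟨P, hP⟩ : ∃ P : ℝ → Matrix (FermionTorus 2 L) (FermionTorus 2 L) ℂ,
      ∀ s, P s = sdwProj 2 L (-t) Δ s := ⟨_, fun _ => rfl⟩
  obtain ⟨c, hc⟩ : ∃ c : ℂ, c = ((|Δ| : ℝ) : ℂ) := ⟨_, rfl⟩
  -- one-body facts
  have hEP : ∀ s, E * P s = P s * E := fun s => by
    rw [hE, hP]; exact sdwE_matrix_mul_sdwProj hL hLe (-t) hΔ s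
  have hK'P : ∀ s, K' * P s = P s * K' := fun s => by
    rw [hK', hP]; exact hopMatrix_diag_mul_sdwProj hL hLe (-t') (-t) Δ s
  have hPh : ∀ s, (P s)ᴴ = P s := fun s => by rw [hP]; exact conjTranspose_sdwProj hL hLe (-t) hΔ s
  have hPP : ∀ s : ℝ, s * s = 1 → P s * P s = P s := fun s hs => by
    rw [hP]; exact sdwProj_mul_self hL hLe (-t) hΔ hs
  have hCpsd : (E + K').PosSemidef := by
    rw [hE, hK']; exact posSemidef_sdwE_add_diag hL (-t) (-t') hΔ h4τ
  have hBpsd : (E - K' - c • (1 : Matrix (FermionTorus 2 L) (FermionTorus 2 L) ℂ)).PosSemidef := by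
    rw [hE, hK', hc]; exact posSemidef_sdwE_sub_diag_sub hL (-t) hΔ hτ h2τ hDτ
  have hdec : ∀ s, sdwH 2 L (-t) Δ s + K' = (E + K') * (1 - P s) - (E - K') * P s := fun s => by
    rw [hE, hK', hP]; exact sdwH_add_hopMatrix_diag_eq hL hLe (-t) (-t') hΔ s
  -- per-spin bound
  have hspin : ∀ (σ : Fin 2) (s : ℝ), s * s = 1 →
      -(((E - K' - c • 1) * P s).trace.re * normSq φ) -
          |Δ| * (star φ ⬝ᵥ ((∑ x : FermionTorus 2 L, numberOp x σ) *ᵥ φ)).re ≤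
        (star φ ⬝ᵥ (dGammaSpin σ (sdwH 2 L (-t) Δ s + K') *ᵥ φ)).re := by
    intro σ s hs
    have h1P : (1 - P s) * (1 - P s) = 1 - P s := by
      rw [Matrix.sub_mul, Matrix.one_mul, Matrix.mul_sub, Matrix.mul_one, hPP s hs]
      abel
    have h1h : (1 - P s)ᴴ = 1 - P s := by rw [conjTranspose_sub, conjTranspose_one, hPh]
    -- `C = (E + K')(1 - P) = (1 - P)(E + K')(1 - P)ᴴ ⪰ 0`
    have hC : ((E + K') * (1 - P s)).PosSemidef := by
      have hcomm : (E + K') * (1 - P s) = (1 - P s) * (E + K') := by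
        rw [Matrix.add_mul, Matrix.mul_add, Matrix.mul_sub, Matrix.mul_sub, Matrix.sub_mul, Matrix.sub_mul,
          Matrix.mul_one, Matrix.one_mul, Matrix.mul_one, Matrix.one_mul, hEP, hK'P]
      have key : (1 - P s) * (E + K') * (1 - P s)ᴴ = (E + K') * (1 - P s) := by
        rw [h1h, ← hcomm, Matrix.mul_assoc, h1P]
      have h := hCpsd.mul_mul_conjTranspose_same (1 - P s)
      rw [key] at h
      exact h
    -- `(E - K' - |Δ|)P = P (E - K' - |Δ|) Pᴴ ⪰ 0`
    have hB : ((E - K' - c • 1) * P s).PosSemidef := by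
      have hcomm : (E - K' - c • 1) * P s = P s * (E - K' - c • 1) := by
        rw [Matrix.sub_mul, Matrix.sub_mul, Matrix.mul_sub, Matrix.mul_sub, Matrix.smul_mul, Matrix.mul_smul,
          Matrix.one_mul, Matrix.mul_one, hEP, hK'P]
      have key : P s * (E - K' - c • 1) * (P s)ᴴ = (E - K' - c • 1) * P s := by
        rw [hPh, ← hcomm, Matrix.mul_assoc, hPP s hs]
      have h := hBpsd.mul_mul_conjTranspose_same (P s)
      rw [key] at h
      exact h
    -- `1 - P ⪰ 0`
    have h1mP : (1 - P s).PosSemidef := by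
      have h := posSemidef_self_mul_conjTranspose (1 - P s)
      rw [h1h, h1P] at h
      exact h
    -- `dΓ(h_s + K') = dΓ(C) - dΓ((E-K'-|Δ|)P) - |Δ| dΓ(P)`
    have hBsplit : (E - K') * P s = (E - K' - c • 1) * P s + c • P s := by
      rw [Matrix.sub_mul (E - K') (c • 1) (P s), Matrix.smul_mul, Matrix.one_mul, sub_add_cancel]
    have hmat : sdwH 2 L (-t) Δ s + K' =
        (E + K') * (1 - P s) + (-1 : ℂ) • ((E - K' - c • 1) * P s) + (-c) • P s := by
      rw [hdec s, hBsplit, neg_smul, one_smul, neg_smul]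
      abel
    have hsplit : dGammaSpin σ (sdwH 2 L (-t) Δ s + K') =
        dGammaSpin σ ((E + K') * (1 - P s)) - dGammaSpin σ ((E - K' - c • 1) * P s) -
          c • dGammaSpin σ (P s) := by
      rw [hmat, dGammaSpin_add, dGammaSpin_add, dGammaSpin_smul, dGammaSpin_smul, neg_smul, one_smul,
        neg_smul]
      abel
    have e1 := re_expect_dGammaSpin_nonneg σ hC φ
    have e2 := re_expect_dGammaSpin_le_trace_mul_normSq σ hB φ
    -- (the generic lemma's `1` carries the `LinearOrder`-derived `DecidableEq`; `convert` bridges it)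
    have h1mP' := h1mP
    have e3 := re_expect_dGammaSpin_le_number σ (P := P s)
      (by convert h1mP' using 4; congr 1; exact Subsingleton.elim _ _) φ
    have e3' := mul_le_mul_of_nonneg_left e3 (abs_nonneg Δ)
    have hexp : (star φ ⬝ᵥ (dGammaSpin σ (sdwH 2 L (-t) Δ s + K') *ᵥ φ)).re =
        (star φ ⬝ᵥ (dGammaSpin σ ((E + K') * (1 - P s)) *ᵥ φ)).re -
          (star φ ⬝ᵥ (dGammaSpin σ ((E - K' - c • 1) * P s) *ᵥ φ)).re -
          |Δ| * (star φ ⬝ᵥ (dGammaSpin σ (P s) *ᵥ φ)).re := by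
      rw [hsplit, Matrix.sub_mulVec, Matrix.sub_mulVec, dotProduct_sub, dotProduct_sub, Complex.sub_re,
        Complex.sub_re, Matrix.smul_mulVec, dotProduct_smul, smul_eq_mul, hc, Complex.re_ofReal_mul]
    rw [hexp]
    linarith [e1, e2, e3']
  -- traces of the two spins together
  have htrE1 : (E * (P 1 + P (-1))).trace = E.trace := by
    rw [hE, hP, hP]; exact trace_sdwE_matrix_mul_sdwProj_add hL (-t) hΔ
  have htrK1 : (K' * (P 1 + P (-1))).trace = 0 := by
    rw [hK', hP, hP]; exact trace_diag_mul_sdwProj_add hL hLe (-t') (-t) hΔ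
  have htrP : (P 1 + P (-1)).trace = (L : ℂ) ^ 2 := by
    rw [hP, hP, trace_add]; exact trace_sdwProj_add hL hLe (-t) hΔ
  have htr : ((E - K' - c • 1) * P 1).trace + ((E - K' - c • 1) * P (-1)).trace =
      E.trace - c * (L : ℂ) ^ 2 := by
    rw [← trace_add, ← Matrix.mul_add, Matrix.sub_mul, Matrix.sub_mul, trace_sub, trace_sub,
      Matrix.smul_mul, Matrix.one_mul, trace_smul, smul_eq_mul, htrE1, htrK1, htrP, sub_zero]
  have htrE : E.trace.re ≤ (L : ℝ) ^ 2 * B := by rw [hE]; exact hB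
  have htr_re : ((E - K' - c • 1) * P 1).trace.re + ((E - K' - c • 1) * P (-1)).trace.re =
      E.trace.re - |Δ| * (L : ℝ) ^ 2 := by
    rw [← Complex.add_re, htr, Complex.sub_re, hc]
    congr 1
    have : ((|Δ| : ℝ) : ℂ) * (L : ℂ) ^ 2 = (((|Δ| * (L : ℝ) ^ 2 : ℝ)) : ℂ) := by push_cast; ring
    rw [this, Complex.ofReal_re]
  -- assemble
  have h0 := hspin 0 1 (by norm_num)
  have h1 := hspin 1 (-1) (by norm_num)
  have hsum := dGammaSpin_sdwH_add_diag_sum (L := L) t t' Δ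
  rw [← hK'] at hsum
  have hN : (star φ ⬝ᵥ (totalNumber *ᵥ φ)).re =
      (star φ ⬝ᵥ ((∑ x : FermionTorus 2 L, numberOp x 0) *ᵥ φ)).re +
        (star φ ⬝ᵥ ((∑ x : FermionTorus 2 L, numberOp x 1) *ᵥ φ)).re := by
    rw [totalNumber_eq_add, Matrix.add_mulVec, dotProduct_add, Complex.add_re]
  have hlhs : (star φ ⬝ᵥ (dGammaSpin 0 (sdwH 2 L (-t) Δ 1 + K') *ᵥ φ)).re +
      (star φ ⬝ᵥ (dGammaSpin 1 (sdwH 2 L (-t) Δ (-1) + K') *ᵥ φ)).re =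
      (star φ ⬝ᵥ (hubbardTorusTT' L t t' 0 *ᵥ φ)).re +
        Δ * (star φ ⬝ᵥ ((dGammaSpin 0 (stagMatrix 2 L) - dGammaSpin 1 (stagMatrix 2 L)) *ᵥ φ)).re := by
    rw [← Complex.add_re, ← dotProduct_add, ← Matrix.add_mulVec, hsum, Matrix.add_mulVec, dotProduct_add,
      Complex.add_re, Matrix.smul_mulVec, dotProduct_smul, smul_eq_mul, Complex.re_ofReal_mul]
  have hnn : 0 ≤ normSq φ := normSq_nonneg φ
  have htr_ns : ((E - K' - c • 1) * P 1).trace.re * normSq φ +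
      ((E - K' - c • 1) * P (-1)).trace.re * normSq φ =
      E.trace.re * normSq φ - |Δ| * (L : ℝ) ^ 2 * normSq φ := by
    rw [← add_mul, htr_re, sub_mul]
  have hEns := mul_le_mul_of_nonneg_right htrE hnn
  rw [hN]
  linarith [h0, h1, hlhs, htr_ns, hEns]


/-! ### §3 Quadratic majorants of `√(x + Δ²)` and the fourth-moment floors -/

/-- **`tr E ≤ L²(α + 4t²β + 36t⁴γ)`** for every quadratic majorant `√(x + Δ²) ≤ α + βx + γx²` on `[0, 16t²]`
(`L ≥ 5`; uses `Σ_k ε_k² = 4t²L²` and `Σ_k ε_k⁴ = 36t⁴L²`). [cite: LiebLoss1993, §8] -/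
theorem trace_sdwE_matrix_le_quad (hL : 5 ≤ L) (t : ℝ) {Δ α β γ : ℝ} (hΔ : Δ ≠ 0)
    (hq : ∀ x : ℝ, 0 ≤ x → x ≤ 16 * t ^ 2 → Real.sqrt (x + Δ ^ 2) ≤ α + β * x + γ * x ^ 2) :
    ((sdwM 2 L t Δ * sdwR 2 L t Δ).trace).re ≤ (L : ℝ) ^ 2 * (α + 4 * t ^ 2 * β + 36 * t ^ 4 * γ) := by
  have hL3 : 3 ≤ L := by omega
  rw [trace_sdwE_matrix hL3 t hΔ, Complex.re_sum]
  simp only [Complex.ofReal_re]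
  have hk : ∀ k : FermionTorus 2 L, sdwE t Δ k ≤ α + β * siteBand t k ^ 2 + γ * (siteBand t k ^ 2) ^ 2 := by
    intro k
    rw [sdwE]
    exact hq _ (sq_nonneg _) (siteBand_sq_le t k)
  have hcard : (Finset.univ : Finset (FermionTorus 2 L)).card = L ^ 2 := by
    rw [Finset.card_univ, card_fermionTorus_eq]
  calc ∑ k : FermionTorus 2 L, sdwE t Δ k
      ≤ ∑ k : FermionTorus 2 L, (α + β * siteBand t k ^ 2 + γ * (siteBand t k ^ 2) ^ 2) :=
        Finset.sum_le_sum fun k _ => hk k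
    _ = (L : ℝ) ^ 2 * (α + 4 * t ^ 2 * β + 36 * t ^ 4 * γ) := by
        have e4 : ∀ k : FermionTorus 2 L, (siteBand t k ^ 2) ^ 2 = siteBand t k ^ 4 := fun k => by ring
        simp only [e4, Finset.sum_add_distrib, Finset.sum_const, hcard, ← Finset.mul_sum,
          sum_siteBand_sq hL3, sum_siteBand_pow_four hL, nsmul_eq_mul]
        push_cast
        ring

/-- **The fourth-moment SDW-reference kinetic floor** (`t' ≤ 0`, `L ≥ 5` even): for every real `Δ ≠ 0` with
`4|t'| ≤ |Δ|`, `|Δ||t'| ≤ 2(t² - t'²)`, every quadratic majorant `√(x + Δ²) ≤ α + βx + γx²` on `[0, 16t²]` and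
every Fock vector `φ`: `-Δ Re⟨φ, Ôφ⟩ + |Δ|(L²‖φ‖² - Re⟨φ, N̂φ⟩) - L²(α + 4t²β + 36t⁴γ)‖φ‖² ≤ Re⟨φ, H(t,t',0)φ⟩`.
[cite: LiebLoss1993, §8, Theorem 8.2] -/
theorem re_expect_hubbardTorusTT'_zero_ge_sdw_quad (hL : 5 ≤ L) (hLe : Even L) (t : ℝ) {t' Δ α β γ : ℝ}
    (ht' : t' ≤ 0) (hΔ : Δ ≠ 0) (h4 : 4 * |t'| ≤ |Δ|) (hD : |Δ| * |t'| ≤ 2 * (t ^ 2 - t' ^ 2))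
    (hq : ∀ x : ℝ, 0 ≤ x → x ≤ 16 * t ^ 2 → Real.sqrt (x + Δ ^ 2) ≤ α + β * x + γ * x ^ 2)
    (φ : Fock (Orb (FermionTorus 2 L))) :
    -Δ * (star φ ⬝ᵥ ((dGammaSpin 0 (stagMatrix 2 L) - dGammaSpin 1 (stagMatrix 2 L)) *ᵥ φ)).re +
        |Δ| * ((L : ℝ) ^ 2 * normSq φ - (star φ ⬝ᵥ (totalNumber *ᵥ φ)).re) -
        (L : ℝ) ^ 2 * (α + 4 * t ^ 2 * β + 36 * t ^ 4 * γ) * normSq φ ≤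
      (star φ ⬝ᵥ (hubbardTorusTT' L t t' 0 *ᵥ φ)).re := by
  have hL3 : 3 ≤ L := by omega
  have hq' : ∀ x : ℝ, 0 ≤ x → x ≤ 16 * (-t) ^ 2 → Real.sqrt (x + Δ ^ 2) ≤ α + β * x + γ * x ^ 2 := by
    intro x h0 h1; rw [neg_sq] at h1; exact hq x h0 h1
  have hB := trace_sdwE_matrix_le_quad hL (-t) hΔ hq'
  rw [neg_sq, show (-t) ^ 4 = t ^ 4 by ring] at hB
  exact re_expect_hubbardTorusTT'_zero_ge_sdw_of_trace_le hL3 hLe t ht' hΔ h4 hD hB φ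

/-- **The fourth-moment energy floor of the Néel mean-field class** (`t' ≤ 0`, `U ≥ 0`, `L ≥ 5` even): under the class
hypotheses (density `n`, staggered magnetisation `m`, `Re⟨D̂⟩ ≥ (n²/4 - m²)L²‖φ‖²), for every `δ > 0` with `4|t'| ≤ δ`,
`δ|t'| ≤ 2(t² - t'²)` and every quadratic majorant `√(x + δ²) ≤ α + βx + γx²` on `[0, 16t²]`:
`Re⟨φ, H(t,t',U)φ⟩ ≥ L²‖φ‖²(2δ|m| + δ(1 - n) - (α + 4t²β + 36t⁴γ) + U(n²/4 - m²))`.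
[cite: BachLiebSolovej1994, §2 eq. (2c.36)] -/
theorem re_expect_hubbardTorusTT'_ge_neelClass_quad (hL : 5 ≤ L) (hLe : Even L) (t : ℝ) {t' U δ n m α β γ : ℝ}
    (ht' : t' ≤ 0) (hU : 0 ≤ U) (hδ : 0 < δ) (h4 : 4 * |t'| ≤ δ) (hD : δ * |t'| ≤ 2 * (t ^ 2 - t' ^ 2))
    (hq : ∀ x : ℝ, 0 ≤ x → x ≤ 16 * t ^ 2 → Real.sqrt (x + δ ^ 2) ≤ α + β * x + γ * x ^ 2)
    (φ : Fock (Orb (FermionTorus 2 L)))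
    (hN : (star φ ⬝ᵥ (totalNumber *ᵥ φ)).re = n * (L : ℝ) ^ 2 * normSq φ)
    (hO : (star φ ⬝ᵥ ((dGammaSpin 0 (stagMatrix 2 L) - dGammaSpin 1 (stagMatrix 2 L)) *ᵥ φ)).re =
      2 * m * (L : ℝ) ^ 2 * normSq φ)
    (hDocc : (n ^ 2 / 4 - m ^ 2) * (L : ℝ) ^ 2 * normSq φ ≤
      (star φ ⬝ᵥ ((∑ x : FermionTorus 2 L, numberOp x 0 * numberOp x 1) *ᵥ φ)).re) :
    (L : ℝ) ^ 2 * normSq φ *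
        (2 * δ * |m| + δ * (1 - n) - (α + 4 * t ^ 2 * β + 36 * t ^ 4 * γ) + U * (n ^ 2 / 4 - m ^ 2)) ≤
      (star φ ⬝ᵥ (hubbardTorusTT' L t t' U *ᵥ φ)).re := by
  have hU' : (star φ ⬝ᵥ (hubbardTorusTT' L t t' U *ᵥ φ)).re =
      (star φ ⬝ᵥ (hubbardTorusTT' L t t' 0 *ᵥ φ)).re +
        U * (star φ ⬝ᵥ ((∑ x : FermionTorus 2 L, numberOp x 0 * numberOp x 1) *ᵥ φ)).re := by
    rw [hubbardTorusTT'_eq_add_smul t t' 0 U, Matrix.add_mulVec, dotProduct_add, Complex.add_re,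
      Matrix.smul_mulVec, dotProduct_smul, smul_eq_mul, Complex.re_ofReal_mul, sub_zero]
  have hnn : 0 ≤ normSq φ := normSq_nonneg φ
  have hL2 : 0 ≤ (L : ℝ) ^ 2 * normSq φ := by positivity
  rcases le_or_gt 0 m with hm | hm
  · have hΔ : (-δ) ≠ 0 := by linarith
    have h4' : 4 * |t'| ≤ |(-δ)| := by rw [abs_neg, abs_of_pos hδ]; exact h4
    have hD' : |(-δ)| * |t'| ≤ 2 * (t ^ 2 - t' ^ 2) := by rw [abs_neg, abs_of_pos hδ]; exact hD
    have hqn : ∀ x : ℝ, 0 ≤ x → x ≤ 16 * t ^ 2 → Real.sqrt (x + (-δ) ^ 2) ≤ α + β * x + γ * x ^ 2 := by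
      intro x h0 h1; rw [neg_sq]; exact hq x h0 h1
    have h := re_expect_hubbardTorusTT'_zero_ge_sdw_quad hL hLe t ht' hΔ h4' hD' hqn φ
    rw [abs_neg, abs_of_pos hδ, hO, hN] at h
    rw [hU', abs_of_nonneg hm]
    nlinarith [mul_le_mul_of_nonneg_left hDocc hU]
  · have hΔ : δ ≠ 0 := hδ.ne'
    have h4' : 4 * |t'| ≤ |δ| := by rw [abs_of_pos hδ]; exact h4
    have hD' : |δ| * |t'| ≤ 2 * (t ^ 2 - t' ^ 2) := by rw [abs_of_pos hδ]; exact hD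
    have h := re_expect_hubbardTorusTT'_zero_ge_sdw_quad hL hLe t ht' hΔ h4' hD' hq φ
    rw [abs_of_pos hδ, hO, hN] at h
    rw [hU', abs_of_neg hm]
    nlinarith [mul_le_mul_of_nonneg_left hDocc hU]

/-- **Per-site form** (`φ ≠ 0`): under the hypotheses of `re_expect_hubbardTorusTT'_ge_neelClass_quad`, the energy per
site of every state of the Néel mean-field class is at least
`2δ|m| + δ(1 - n) - (α + 4t²β + 36t⁴γ) + U(n²/4 - m²)`. [cite: BachLiebSolovej1994, §2 eq. (2c.36)] -/
theorem neelClass_energy_per_site_ge_quad (hL : 5 ≤ L) (hLe : Even L) (t : ℝ) {t' U δ n m α β γ : ℝ}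
    (ht' : t' ≤ 0) (hU : 0 ≤ U) (hδ : 0 < δ) (h4 : 4 * |t'| ≤ δ) (hD : δ * |t'| ≤ 2 * (t ^ 2 - t' ^ 2))
    (hq : ∀ x : ℝ, 0 ≤ x → x ≤ 16 * t ^ 2 → Real.sqrt (x + δ ^ 2) ≤ α + β * x + γ * x ^ 2)
    {φ : Fock (Orb (FermionTorus 2 L))} (hφ : φ ≠ 0)
    (hN : (star φ ⬝ᵥ (totalNumber *ᵥ φ)).re = n * (L : ℝ) ^ 2 * normSq φ)
    (hO : (star φ ⬝ᵥ ((dGammaSpin 0 (stagMatrix 2 L) - dGammaSpin 1 (stagMatrix 2 L)) *ᵥ φ)).re =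
      2 * m * (L : ℝ) ^ 2 * normSq φ)
    (hDocc : (n ^ 2 / 4 - m ^ 2) * (L : ℝ) ^ 2 * normSq φ ≤
      (star φ ⬝ᵥ ((∑ x : FermionTorus 2 L, numberOp x 0 * numberOp x 1) *ᵥ φ)).re) :
    2 * δ * |m| + δ * (1 - n) - (α + 4 * t ^ 2 * β + 36 * t ^ 4 * γ) + U * (n ^ 2 / 4 - m ^ 2) ≤
      (star φ ⬝ᵥ (hubbardTorusTT' L t t' U *ᵥ φ)).re / ((L : ℝ) ^ 2 * normSq φ) := by
  have h := re_expect_hubbardTorusTT'_ge_neelClass_quad hL hLe t ht' hU hδ h4 hD hq φ hN hO hDocc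
  have hpos : 0 < normSq φ := by
    rcases (normSq_nonneg φ).lt_or_eq with hlt | heq
    · exact hlt
    · exact absurd (eq_zero_of_normSq_eq_zero heq.symm) hφ
  have hL0 : (0 : ℝ) < (L : ℝ) ^ 2 := by
    have : (0 : ℝ) < L := by exact_mod_cast (lt_of_lt_of_le (by norm_num : 0 < 5) hL)
    positivity
  rw [le_div_iff₀ (mul_pos hL0 hpos)]
  linarith

end Main
end NeelClassFloor

end Summit.Ventures.CertifiedManyBodySolver.Observables

end
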